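import Literature.AlgebraicGeometry.Resolution.BlowupAlgebraPresentation
import Mathlib.RingTheory.RegularLocalRing.Polynomial
import HarnessLib

/-!
# The graph chart `R[I/y] ≅ k[Y, X']` of the blow-up of the `A₂` surface `yz + x³ = 0`
# (crux `FrobeniusLadder.FRationalResolution`, line `Sketch`)

Stub `stub_chart_graph_cube` (worker U3) of the skeleton `Sketch` for crux
stmt-ResolutionOfSingularities-15317. Let `R` be a `k`-algebra generated by `x, y, z` with
`yz + x³ = 0`, `I = (x, y, z)`, and suppose `R` admits the test map
`θ : R → k[Y, X'][1/Y]`, `θ y = Y`, `θ x = X'Y`, `θ z = −X'³Y²`. Then the affine blowup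
algebra `R[I/y] ⊆ R[1/y]` (`blowupAlgebra I y`, image model of `AffineBlowupAlgebra.lean`) is a
regular ring. Indeed the `k`-algebra map `φ : k[Y, X'] → R[1/y]`, `Y ↦ y`, `X' ↦ u := x/y`, is
an isomorphism onto `R[I/y]`:

* `z = −u³y²` and `z/y = −u³y` in `R[1/y]` (`algebraMap_z_eq_of_graph_cube`,
  `div_z_eq_of_graph_cube`): `y²·(z/y) = yz = −x³ = −u³y³` and `y` is a unit of `R[1/y]`;
* the image of `φ` lies in `R[I/y]` (`y`, `x/y ∈ R[I/y]`) and contains it: `R[I/y]` is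
  generated over `R` by the `r/y`, `r = ax + by + cz ∈ I`, i.e. by `u`, `1`, `z/y = −u³y` over
  the image of `R = k[x, y, z]`, and `x = u·y`, `y`, `z = −u³y²` are polynomials in `y, u`;
* `φ` is injective: `θ` extends to `θ' : R[1/y] → k[Y, X'][1/Y]` (`θ y = Y` is a unit), with
  `θ'(u) = X'` (`θ'(u)·Y = θ x = X'Y`), so `θ' ∘ φ` is the injective localization map
  `k[Y, X'] → k[Y, X'][1/Y]`.

Regularity of `k[Y, X']` is Mathlib's instance `MvPolynomial.isRegularRing_of_isRegularRing`;
transport along the ring isomorphism by `IsRegularRing.of_ringEquiv`.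
-/

set_option linter.dupNamespace false
-- single-problem summit: the doubled namespace component is forced

namespace Summit.ResolutionOfSingularities.ResolutionOfSingularities.Theorems.FRationalResolution

open Literature.AlgebraicGeometry.Resolution

/-- In `R[1/y]`, the relation `yz + x³ = 0` reads `z = −(x/y)³·y²`. -/
theorem algebraMap_z_eq_of_graph_cube {R : Type*} [CommRing R] {x y z : R}
    (hrel : y * z + x ^ 3 = 0) :
    algebraMap R (Localization.Away y) z =
      -((algebraMap R (Localization.Away y) x * IsLocalization.Away.invSelf y) ^ 3 *
        algebraMap R (Localization.Away y) y ^ 2) := by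
  have hYe : algebraMap R (Localization.Away y) y * IsLocalization.Away.invSelf y = 1 :=
    IsLocalization.Away.mul_invSelf y
  have hrelL : algebraMap R (Localization.Away y) y * algebraMap R (Localization.Away y) z =
      -(algebraMap R (Localization.Away y) x ^ 3) := by
    have h := congrArg (algebraMap R (Localization.Away y)) hrel
    rw [map_add, map_mul, map_pow, map_zero] at h
    exact eq_neg_of_add_eq_zero_left h
  linear_combination
    (algebraMap R (Localization.Away y) x ^ 3 * IsLocalization.Away.invSelf y *
        (IsLocalization.Away.invSelf y * algebraMap R (Localization.Away y) y + 1) -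
      algebraMap R (Localization.Away y) z) * hYe + IsLocalization.Away.invSelf y * hrelL

/-- In `R[1/y]`, the relation `yz + x³ = 0` gives `z/y = −(x/y)³·y`. -/
theorem div_z_eq_of_graph_cube {R : Type*} [CommRing R] {x y z : R}
    (hrel : y * z + x ^ 3 = 0) :
    algebraMap R (Localization.Away y) z * IsLocalization.Away.invSelf y =
      -((algebraMap R (Localization.Away y) x * IsLocalization.Away.invSelf y) ^ 3 *
        algebraMap R (Localization.Away y) y) := by
  have hYe : algebraMap R (Localization.Away y) y * IsLocalization.Away.invSelf y = 1 :=
    IsLocalization.Away.mul_invSelf y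
  rw [algebraMap_z_eq_of_graph_cube hrel]
  linear_combination
    (-((algebraMap R (Localization.Away y) x * IsLocalization.Away.invSelf y) ^ 3 *
      algebraMap R (Localization.Away y) y)) * hYe

/-- STUB `stub_chart_graph_cube` (worker U3) — **GRAPH CHART OF THE `A₂` SURFACE
`yz + x³ = 0`.** `R` a `k`-algebra generated by `x, y, z` with `yz + x³ = 0`, and a test map
`θ : R → k[Y, X'][1/Y]` with `θ y = Y`, `θ x = X'Y`, `θ z = −X'³Y²`. Then the affine blowup
algebra `R[I/y]`, `I = (x, y, z)`, is a regular ring: `k[Y, X'] → R[I/y]`, `Y ↦ y`, `X' ↦ x/y`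
is surjective (`R[I/y]` is generated over `R` by `x/y`, `y/y = 1`, `z/y = −(x/y)³y`, and
`x = y·(x/y)`, `z = −(x/y)³y²`) and injective (composed with the extension of `θ` to `R[1/y]` it
is the localization map `k[Y, X'] → k[Y, X'][1/Y]`), and `k[Y, X']` is regular. -/
theorem stub_chart_graph_cube (k R : Type) [Field k] [CommRing R] [Algebra k R] (x y z : R)
    (hrel : y * z + x ^ 3 = 0) (hgen : Algebra.adjoin k {x, y, z} = ⊤)
    (θ : R →ₐ[k] Localization.Away (MvPolynomial.X 0 : MvPolynomial (Fin 2) k))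
    (hθy : θ y = algebraMap (MvPolynomial (Fin 2) k) _ (MvPolynomial.X 0))
    (hθx : θ x = algebraMap (MvPolynomial (Fin 2) k) _ (MvPolynomial.X 1 * MvPolynomial.X 0))
    (hθz : θ z = -(algebraMap (MvPolynomial (Fin 2) k) _
      (MvPolynomial.X 1 ^ 3 * MvPolynomial.X 0 ^ 2))) :
    IsRegularRing (blowupAlgebra (Ideal.span {x, y, z}) y) := by
  -- `hθz` (the test map is compatible with `z = -(x/y)³y²`) follows from the other hypotheses
  -- and is not used below; it is part of the registered signature.
  have _ := hθz
  have hxI : x ∈ Ideal.span {x, y, z} := Ideal.subset_span (Set.mem_insert _ _)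
  -- the fraction `u = x/y` and `Y = y/1` in `R[1/y]`
  set u : Localization.Away y :=
    algebraMap R (Localization.Away y) x * IsLocalization.Away.invSelf y
  set Y : Localization.Away y := algebraMap R (Localization.Away y) y
  have hYinv : Y * IsLocalization.Away.invSelf y = 1 := IsLocalization.Away.mul_invSelf y
  have huY : u * Y = algebraMap R (Localization.Away y) x := div_mul_algebraMap y x
  have hz : algebraMap R (Localization.Away y) z = -(u ^ 3 * Y ^ 2) :=
    algebraMap_z_eq_of_graph_cube hrel
  have hv :
      algebraMap R (Localization.Away y) z * IsLocalization.Away.invSelf y = -(u ^ 3 * Y) :=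
    div_z_eq_of_graph_cube hrel
  -- the parametrisation `φ : k[Y, X'] → R[1/y]`, `Y ↦ y`, `X' ↦ u`
  let φ : MvPolynomial (Fin 2) k →ₐ[k] Localization.Away y := MvPolynomial.aeval ![Y, u]
  have hφ0 : φ (MvPolynomial.X 0) = Y := by
    simp only [φ, MvPolynomial.aeval_X, Matrix.cons_val_zero]
  have hφ1 : φ (MvPolynomial.X 1) = u := by
    simp only [φ, MvPolynomial.aeval_X, Matrix.cons_val_one, Matrix.cons_val_fin_one]
  have hφC : ∀ c : k, φ (MvPolynomial.C c) =
      algebraMap R (Localization.Away y) (algebraMap k R c) := fun c => by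
    rw [MvPolynomial.algHom_C, IsScalarTower.algebraMap_apply k R (Localization.Away y)]
  -- (a) the image of `φ` lies in `R[I/y]`
  have hφB : ∀ p, φ p ∈ blowupAlgebra (Ideal.span {x, y, z}) y := by
    intro p
    induction p using MvPolynomial.induction_on with
    | C c =>
      rw [hφC]
      exact Subalgebra.algebraMap_mem _ _
    | add p q hp hq =>
      rw [map_add]
      exact Subalgebra.add_mem _ hp hq
    | mul_X p i hp =>
      rw [map_mul]
      refine Subalgebra.mul_mem _ hp ?_
      revert i
      refine Fin.forall_fin_two.mpr ⟨?_, ?_⟩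
      · rw [hφ0]
        exact Subalgebra.algebraMap_mem _ y
      · rw [hφ1]
        exact div_mem_blowupAlgebra _ y hxI
  -- (b) `R = k[x, y, z]` maps into the image of `φ`: `x = u y`, `y`, `z = -u³ y²`
  have hRφ : ∀ r : R, algebraMap R (Localization.Away y) r ∈ φ.range := by
    have h : Algebra.adjoin k {x, y, z} ≤
        φ.range.comap (IsScalarTower.toAlgHom k R (Localization.Away y)) := by
      refine Algebra.adjoin_le ?_
      intro r hr
      rw [SetLike.mem_coe, Subalgebra.mem_comap, IsScalarTower.toAlgHom_apply,
        AlgHom.mem_range]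
      rcases hr with hr | hr | hr
      · rw [hr]  -- `r = x`
        exact ⟨MvPolynomial.X 1 * MvPolynomial.X 0, by rw [map_mul, hφ1, hφ0, huY]⟩
      · rw [hr]  -- `r = y`
        exact ⟨MvPolynomial.X 0, hφ0⟩
      · rw [Set.mem_singleton_iff] at hr
        rw [hr]  -- `r = z`
        exact ⟨-(MvPolynomial.X 1 ^ 3 * MvPolynomial.X 0 ^ 2), by
          rw [map_neg, map_mul, map_pow, map_pow, hφ1, hφ0, hz]⟩
    intro r
    have hr : r ∈ Algebra.adjoin k {x, y, z} := by
      rw [hgen]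
      exact Algebra.mem_top
    have := h hr
    rwa [Subalgebra.mem_comap, IsScalarTower.toAlgHom_apply] at this
  -- (c) `R[I/y]` lies in the image of `φ`
  have hBφ : ∀ w ∈ blowupAlgebra (Ideal.span {x, y, z}) y, w ∈ φ.range := by
    intro w hw
    induction hw using Algebra.adjoin_induction with
    | mem w hw =>
      obtain ⟨r, hr, rfl⟩ := hw
      refine Submodule.span_induction
        (p := fun r _ => algebraMap R (Localization.Away y) r * IsLocalization.Away.invSelf y ∈
          φ.range) ?_ ?_ ?_ ?_ hr
      · intro r hr
        rcases hr with hr | hr | hr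
        · rw [hr]  -- `x/y = u`
          exact φ.mem_range.mpr ⟨MvPolynomial.X 1, hφ1⟩
        · rw [hr, hYinv]  -- `y/y = 1`
          exact Subalgebra.one_mem _
        · rw [Set.mem_singleton_iff] at hr
          rw [hr, hv]  -- `z/y = -u³y`
          exact Subalgebra.neg_mem _ (Subalgebra.mul_mem _
            (Subalgebra.pow_mem _ (φ.mem_range.mpr ⟨MvPolynomial.X 1, hφ1⟩) 3)
            (φ.mem_range.mpr ⟨MvPolynomial.X 0, hφ0⟩))
      · rw [map_zero, zero_mul]
        exact Subalgebra.zero_mem _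
      · intro a b _ _ ha hb
        rw [map_add, add_mul]
        exact Subalgebra.add_mem _ ha hb
      · intro c a _ ha
        rw [smul_eq_mul, map_mul, mul_assoc]
        exact Subalgebra.mul_mem _ (hRφ c) ha
    | algebraMap r => exact hRφ r
    | add a b _ _ ha hb => exact Subalgebra.add_mem _ ha hb
    | mul a b _ _ ha hb => exact Subalgebra.mul_mem _ ha hb
  -- (d) `φ` is injective: `θ` extends to `θ' : R[1/y] → k[Y, X'][1/Y]` and `θ' ∘ φ` is the
  -- localization map
  have hunit :
      IsUnit ((θ : R →+* Localization.Away (MvPolynomial.X 0 : MvPolynomial (Fin 2) k)) y) := by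
    rw [AlgHom.coe_toRingHom, hθy]
    exact IsLocalization.Away.algebraMap_isUnit _
  let θ' :
      Localization.Away y →+* Localization.Away (MvPolynomial.X 0 : MvPolynomial (Fin 2) k) :=
    IsLocalization.Away.lift y hunit
  have hθ' : ∀ r : R, θ' (algebraMap R (Localization.Away y) r) = θ r := fun r =>
    IsLocalization.Away.lift_eq y hunit r
  have hX0 : IsUnit (algebraMap (MvPolynomial (Fin 2) k)
      (Localization.Away (MvPolynomial.X 0 : MvPolynomial (Fin 2) k)) (MvPolynomial.X 0)) :=
    IsLocalization.Away.algebraMap_isUnit _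
  have hcomp : θ'.comp (φ : MvPolynomial (Fin 2) k →+* Localization.Away y) =
      algebraMap (MvPolynomial (Fin 2) k)
        (Localization.Away (MvPolynomial.X 0 : MvPolynomial (Fin 2) k)) := by
    refine MvPolynomial.ringHom_ext (fun c => ?_) (Fin.forall_fin_two.mpr ⟨?_, ?_⟩)
    · rw [RingHom.comp_apply, AlgHom.coe_toRingHom, hφC, hθ', AlgHom.commutes,
        IsScalarTower.algebraMap_apply k (MvPolynomial (Fin 2) k)
          (Localization.Away (MvPolynomial.X 0 : MvPolynomial (Fin 2) k)),
        MvPolynomial.algebraMap_eq]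
    · -- `θ'(φ Y) = θ y = Y`
      rw [RingHom.comp_apply, AlgHom.coe_toRingHom, hφ0, hθ', hθy]
    · -- `θ'(φ X') = θ'(u)` and `θ'(u) · Y = θ x = X' Y`
      rw [RingHom.comp_apply, AlgHom.coe_toRingHom, hφ1]
      refine hX0.mul_left_inj.mp ?_
      rw [← hθy, ← hθ' y, ← map_mul, huY, hθ', hθ', hθx, hθy, map_mul]
  have hinjT : Function.Injective (algebraMap (MvPolynomial (Fin 2) k)
      (Localization.Away (MvPolynomial.X 0 : MvPolynomial (Fin 2) k))) :=
    IsLocalization.injective _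
      (powers_le_nonZeroDivisors_of_noZeroDivisors (MvPolynomial.X_ne_zero 0))
  have hφinj : Function.Injective φ := by
    intro a b hab
    apply hinjT
    rw [← hcomp, RingHom.comp_apply, RingHom.comp_apply, AlgHom.coe_toRingHom, hab]
  -- (e) `φ` co-restricts to a ring isomorphism `k[Y, X'] ≃ R[I/y]`
  let ψ : MvPolynomial (Fin 2) k →+* blowupAlgebra (Ideal.span {x, y, z}) y :=
    (φ : MvPolynomial (Fin 2) k →+* Localization.Away y).codRestrict
      (blowupAlgebra (Ideal.span {x, y, z}) y) hφB
  have hψ : Function.Bijective ψ := by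
    refine ⟨fun a b hab => hφinj (congrArg Subtype.val hab), fun w => ?_⟩
    obtain ⟨p, hp⟩ := φ.mem_range.mp (hBφ w.1 w.2)
    exact ⟨p, Subtype.ext hp⟩
  exact IsRegularRing.of_ringEquiv (RingEquiv.ofBijective ψ hψ)

end Summit.ResolutionOfSingularities.ResolutionOfSingularities.Theorems.FRationalResolution
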